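/-
Copyright (c) 2026 the pub-hodgecm-mathlib formalisation cell (harness21).  Prover seat hodgecm-mathlib-F0P3-p01 (g31), «(D-RAM) FOUR-FRAME» road of crux H413, line LH4, MS ROAD A,
STAGE B ∕ B9 (LH4-p10 (g2) SPEC-StageB v2-B5split §B5 (iii), MEMO v2.1 §T2.3): brick B5 (iii) «GLUED STABILISER INDEX», GENERAL CORNER EXPONENT (type-0 and type-2 frames at once).  2026-09-04.
-/
import Summits.HodgeConjecture.HodgeConjecture.Theorems.F0P3cDyRamDiagonalGluedStabiliserIndex   -- ★ p855926 (this seat): B5 (iii) at corner `2ρ+s`; brings ★ FILE 1 `…GluedFixedStabiliser` (lineariser, level groups, ratio map), ★ B1, ★ TorusDefs, ★ HNFStability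
import HarnessLib

/-!
# Crux `H413`, MS ROAD A, STAGE B ∕ B9: «GLUED STABILISER INDEX — GENERAL CORNER» `[𝒰 : S_F(latt V)] = (q−1)q^{⌈(ρ+s+e)∕2⌉−1} · (q−1)q^{⌈(2ρ+e)∕2⌉−1}`

Cell `hodgecm-mathlib` (D-0151), FLOOR 0, crux item H413 = `stmt-HodgeConjecture-24833`; lane `--supports stmt-HodgeConjecture-24833 --as helper` (count-neutral).  THEOREMS ONLY
(no `def`, no instance, no notation, no `sorry`).  Sequel of ★ p855896 `F0P3cDyRamDiagonalGluedFixedStabiliser` + ★ p855926 `F0P3cDyRamDiagonalGluedStabiliserIndex` (B5 (iii) for the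
type-0 glued frames, corner exponent `c = 2ρ + s`): the SAME two-step computation for the frame
`V = (1 0 0; x ϖ^ρ 0; xζ + y″  ϖ^ρζ  ϖ^{2ρ+s+e})`, `|x| = |ζ| = 1`, `|y″| = |ϖ|^s`, `ρ ≥ 1`, ANY `e ≥ 0` — `e = 0` is type 0 (★ FILE 2), `e = 1` is the TYPE-2 glued stratum `G₁(2ρ+1, s)` of
LH4-p10 (g2) MEMO v2.1 §T2.3 (`b = ρ`, `c = r + s = 2ρ+1+s`, `v z = ρ`, `v y″ = s`), whose B9 twin of B5 (iii) this file is.  Criterion (R) at level `ρ+s` as in type 0 (MEMO §T2.3 (C12)).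

WHAT IS PROVED.  With `c = 2ρ+s+e`: `diag(u)·latt V = latt V ⟺` (a) `|u₁−u₀| ≤ |ϖ|^ρ` ∧ (b) `|u₂−u₁| ≤ |ϖ|^{c−ρ} = |ϖ|^{ρ+s+e}` ∧ (c) `|xζ(u₂−u₁) + y″(u₂−u₀)| ≤ |ϖ|^c`
(`mem_latticeStabilizer_latt_glued_corner_iff`); dividing (c) by `y″` with a lineariser `g` (`|xζ − g y″| ≤ |ϖ|^ρ`, `|g|·|ϖ|^s ≤ 1`; ★ FILE 1 `lineariser_of_criterionR` gives `g = ζσζ∕f` from (R))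
turns it into (c′) `|g(u₂−u₁) + (u₂−u₀)| ≤ |ϖ|^{c−s} = |ϖ|^{2ρ+e}`, and (b) + (c′) ⟹ (a) as soon as `c − s ≥ 2ρ` (`glued_corner_iff_corner`, `glued_first_of_corner_corner`,
`mem_fixedUnitStabilizer_latt_glued_corner_iff`).  Hence `S_F ≤ S₁ := {u ∈ 𝒰 | u₁∕u₂ ∈ U_{ρ+s+e}} ≤ 𝒰`, `[𝒰 : S₁] = (q−1)q^{⌈(ρ+s+e)∕2⌉−1}` (★ FILE 2 `relIndex_ratioLevel_fixedUnitTorus_eq`),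
and `[S₁ : S_F] = [U_F : U_{F,2ρ+e}] = (q−1)q^{⌈(2ρ+e)∕2⌉−1}` by the twisted homomorphism `u ↦ (u₀∕u₂)(1 + g(1 − u₁∕u₂))⁻¹` into `K^×∕U_{2ρ+e}` (its defect `(g+g²)(1−a)(1−a′)` is
`|ϖ|^{2ρ+2e}`-small: `v_defect_le_corner`; kernel `S_F`, image `U_F·U_{2ρ+e}∕U_{2ρ+e}`; ★ B1 (C4)) — `relIndex_fixedUnitStabilizer_ratioLevel_corner_eq`.  HEADS:
**`relIndex_fixedUnitStabilizer_latt_glued_corner_eq`** (under (R)), `…_of_lineariser`, `stabiliserWeight_latt_glued_corner_eq`, and the type-2 letters `e = 1`: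
**`relIndex_fixedUnitStabilizer_latt_glued_typeTwo_eq`** `= ((q−1)q^{(ρ+s+2)∕2−1})·((q−1)q^{ρ})`, `stabiliserWeight_latt_glued_typeTwo_eq`.
FLAG (for B9, LH4-p10 (g2) MEMO v2.1 §T2.3): at `e = 1` the index is `(q−1)²·q^{⌊(ρ+s)∕2⌋ + ρ}`, which equals the memo's solution-measure denominator `(q−1)²q^{ρ+⌈(ρ+s)∕2⌉−1}` for
ODD `ρ+s` and is `q` TIMES it for EVEN `ρ+s` — the parity ghost the memo flags for `H(r)`; the kernel decides here for the stabiliser side.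

HONEST LABEL.  Count-neutral (`--supports`); the census laws (MS) stay PROVER TARGETS until the Stage B ∕ B9 assemblies land; `HC_CM` is proved only modulo the 7 printed citations
(2 remaining named inputs: hLiu418 = `stmt-HodgeConjecture-24832`, h413 = `stmt-HodgeConjecture-24833`) until rung 0 closes.

## References
* [Kottwitz1986BaseChangeUnits] R. E. Kottwitz, *Base change for unit elements of Hecke algebras*, Compositio Math. 60 (1986), §1 pp. 240–241 (orbital integrals of units as weighted
  fixed-lattice counts; the torus stabilisers).
* [Serre1979] J.-P. Serre, *Local Fields*, GTM 67 (1979), Ch. II §3, Ch. IV §2 Prop. 6 (the filtration `U ⊃ U¹ ⊃ U² ⊃ …` and its indices).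
* [Serre1980Trees] J.-P. Serre, *Trees*, Springer (1980), Ch. II §1.1 (lattices, diagonal action, Hermite normal form).
-/

set_option autoImplicit false

noncomputable section

namespace Summit.HodgeConjecture.HodgeConjecture.Cruxes.H413.F0P3cDyRamDiagonalGluedStabiliserIndexCorner

open Matrix
open Literature.NumberTheory.Automorphic Literature.NumberTheory.Automorphic.HermitianLattice Literature.NumberTheory.Automorphic.UnitaryGroup
open Literature.NumberTheory.Automorphic.UnitaryLatticeTree
open Literature.NumberTheory.LocalFields.WildQuadraticDatum
open Summit.HodgeConjecture.HodgeConjecture.Cruxes.H413.F0P3cDyRamDiagonalTorusDefs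
open Summit.HodgeConjecture.HodgeConjecture.Cruxes.H413.F0P3cDyRamDiagonalHNFStability
open Summit.HodgeConjecture.HodgeConjecture.Cruxes.H413.F0P3cDyRamDiagonalGluedFixedStabiliser
open Summit.HodgeConjecture.HodgeConjecture.Cruxes.H413.F0P3cDyRamDiagonalGluedStabiliserIndex
open scoped Valued WithZero Matrix MatrixGroups

variable {K : Type*} [Field K] [Valued K ℤᵐ⁰]

/-! ## §1  Valuation lemmas at a general corner `c = 2ρ + s + e` -/

/-- **LINEARISATION OF THE CORNER CONGRUENCE, general corner.**  If `|κ − g·y″| ≤ |ϖ|^ρ`, `|y″| = |ϖ|^s` and `|δ₁| ≤ |ϖ|^{ρ+s+e}`, then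
`|κδ₁ + y″δ₂| ≤ |ϖ|^{2ρ+s+e} ⟺ |gδ₁ + δ₂| ≤ |ϖ|^{2ρ+e}`. [cite: Kottwitz1986BaseChangeUnits, §1 pp. 240–241] -/
theorem glued_corner_iff_corner {ϖ : K} (hϖ0 : ϖ ≠ 0) (ρ s e : ℕ) {κ y'' g δ₁ δ₂ : K} (hy'' : Valued.v y'' = Valued.v ϖ ^ s)
    (hlin : Valued.v (κ - g * y'') ≤ Valued.v ϖ ^ ρ) (hδ₁ : Valued.v δ₁ ≤ Valued.v ϖ ^ (ρ + s + e)) :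
    Valued.v (κ * δ₁ + y'' * δ₂) ≤ Valued.v ϖ ^ (2 * ρ + s + e) ↔ Valued.v (g * δ₁ + δ₂) ≤ Valued.v ϖ ^ (2 * ρ + e) := by
  have hvϖ : 0 < Valued.v ϖ := (Valuation.pos_iff _).2 hϖ0
  have key : κ * δ₁ + y'' * δ₂ = y'' * (g * δ₁ + δ₂) + (κ - g * y'') * δ₁ := by ring
  have hsmall : Valued.v ((κ - g * y'') * δ₁) ≤ Valued.v ϖ ^ (2 * ρ + s + e) := by
    rw [map_mul]
    calc Valued.v (κ - g * y'') * Valued.v δ₁ ≤ Valued.v ϖ ^ ρ * Valued.v ϖ ^ (ρ + s + e) := mul_le_mul' hlin hδ₁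
      _ = Valued.v ϖ ^ (2 * ρ + s + e) := by rw [← pow_add]; congr 1; ring
  have hsplit : Valued.v ϖ ^ (2 * ρ + s + e) = Valued.v ϖ ^ s * Valued.v ϖ ^ (2 * ρ + e) := by rw [← pow_add]; congr 1; ring
  rw [key]
  constructor
  · intro h
    have h2 : Valued.v (y'' * (g * δ₁ + δ₂)) ≤ Valued.v ϖ ^ (2 * ρ + s + e) := by
      have e1 : y'' * (g * δ₁ + δ₂) = (y'' * (g * δ₁ + δ₂) + (κ - g * y'') * δ₁) - (κ - g * y'') * δ₁ := by ring
      rw [e1]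
      exact (Valuation.map_sub _ _ _).trans (max_le h hsmall)
    rw [map_mul, hy'', hsplit] at h2
    exact (mul_le_mul_iff_right₀ (pow_pos hvϖ _)).1 h2
  · intro h
    refine (Valuation.map_add _ _ _).trans (max_le ?_ hsmall)
    rw [map_mul, hy'', hsplit]
    exact mul_le_mul_right h _

/-- `|g|·|ϖ|^s ≤ 1` and `|b − 1| ≤ |ϖ|^{ρ+s+e}` give `|g(1 − b)| ≤ |ϖ|^{ρ+e}`. [cite: Serre1979, Ch. IV §2 Prop. 6] -/
theorem v_mul_one_sub_le_corner {ϖ : K} (ρ s e : ℕ) {g b : K} (hg : Valued.v g * Valued.v ϖ ^ s ≤ 1)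
    (hb : Valued.v (b - 1) ≤ Valued.v ϖ ^ (ρ + s + e)) : Valued.v (g * (1 - b)) ≤ Valued.v ϖ ^ (ρ + e) := by
  rw [map_mul, Valuation.map_sub_swap]
  calc Valued.v g * Valued.v (b - 1) ≤ Valued.v g * Valued.v ϖ ^ (ρ + s + e) := mul_le_mul_right hb _
    _ = (Valued.v g * Valued.v ϖ ^ s) * Valued.v ϖ ^ (ρ + e) := by
        rw [show ρ + s + e = s + (ρ + e) by ring, pow_add, mul_assoc]
    _ ≤ 1 * Valued.v ϖ ^ (ρ + e) := mul_le_mul_left hg _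
    _ = Valued.v ϖ ^ (ρ + e) := one_mul _

/-- **THE FIRST CONGRUENCE IS IMPLIED, general corner**: `|g|·|ϖ|^s ≤ 1`, `|δ₁| ≤ |ϖ|^{ρ+s+e}`, `|gδ₁ + δ₂| ≤ |ϖ|^{2ρ+e}` ⟹ `|δ₂ − δ₁| ≤ |ϖ|^ρ` (needs only `c − s ≥ 2ρ`).
[cite: Kottwitz1986BaseChangeUnits, §1 pp. 240–241] -/
theorem glued_first_of_corner_corner {ϖ : K} (hϖ1 : Valued.v ϖ ≤ 1) (ρ s e : ℕ) {g δ₁ δ₂ : K} (hg : Valued.v g * Valued.v ϖ ^ s ≤ 1)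
    (hδ₁ : Valued.v δ₁ ≤ Valued.v ϖ ^ (ρ + s + e)) (hc : Valued.v (g * δ₁ + δ₂) ≤ Valued.v ϖ ^ (2 * ρ + e)) :
    Valued.v (δ₂ - δ₁) ≤ Valued.v ϖ ^ ρ := by
  have e1 : δ₂ - δ₁ = (g * δ₁ + δ₂) - (g * δ₁ + δ₁) := by ring
  have hρ2 : Valued.v ϖ ^ (2 * ρ + e) ≤ Valued.v ϖ ^ ρ := pow_le_pow_right_of_le_one' hϖ1 (by omega)
  have hρs : Valued.v ϖ ^ (ρ + s + e) ≤ Valued.v ϖ ^ ρ := pow_le_pow_right_of_le_one' hϖ1 (by omega)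
  have hρe : Valued.v ϖ ^ (ρ + e) ≤ Valued.v ϖ ^ ρ := pow_le_pow_right_of_le_one' hϖ1 (by omega)
  have hgδ : Valued.v (g * δ₁) ≤ Valued.v ϖ ^ ρ := by
    have h := v_mul_one_sub_le_corner ρ s e hg (b := 1 - δ₁) (by rw [sub_sub_cancel_left, Valuation.map_neg]; exact hδ₁)
    rw [sub_sub_cancel] at h
    exact h.trans hρe
  rw [e1]
  exact (Valuation.map_sub _ _ _).trans (max_le (hc.trans hρ2) ((Valuation.map_add _ _ _).trans (max_le hgδ (hδ₁.trans hρs))))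

/-- **THE DEFECT OF `c(a) = 1 + g(1−a)`, general corner**: `|c(a)c(a′) − c(aa′)| ≤ |ϖ|^{2ρ+e}` when `|g|·|ϖ|^s ≤ 1`, `|ϖ| ≤ 1`, `|a−1|, |a′−1| ≤ |ϖ|^{ρ+s+e}`
(`c(a)c(a′) − c(aa′) = (g + g²)(1−a)(1−a′)`, both terms `|ϖ|^{2ρ+2e}`-small). [cite: Serre1979, Ch. IV §2 Prop. 6] -/
theorem v_defect_le_corner {ϖ : K} (hϖ1 : Valued.v ϖ ≤ 1) (ρ s e : ℕ) {g a a' : K} (hg : Valued.v g * Valued.v ϖ ^ s ≤ 1)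
    (ha : Valued.v (a - 1) ≤ Valued.v ϖ ^ (ρ + s + e)) (ha' : Valued.v (a' - 1) ≤ Valued.v ϖ ^ (ρ + s + e)) :
    Valued.v ((1 + g * (1 - a)) * (1 + g * (1 - a')) - (1 + g * (1 - a * a'))) ≤ Valued.v ϖ ^ (2 * ρ + e) := by
  have e1 : (1 + g * (1 - a)) * (1 + g * (1 - a')) - (1 + g * (1 - a * a')) = g * (1 - a) * (1 - a') + (g * (1 - a)) * (g * (1 - a')) := by ring
  have hρs : Valued.v ϖ ^ (ρ + s + e) ≤ Valued.v ϖ ^ ρ := pow_le_pow_right_of_le_one' hϖ1 (by omega)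
  have hρe : Valued.v ϖ ^ (ρ + e) ≤ Valued.v ϖ ^ ρ := pow_le_pow_right_of_le_one' hϖ1 (by omega)
  have h2ρ : Valued.v ϖ ^ (2 * ρ + e) = Valued.v ϖ ^ (ρ + e) * Valued.v ϖ ^ ρ := by rw [← pow_add]; congr 1; ring
  rw [e1, h2ρ]
  refine (Valuation.map_add _ _ _).trans (max_le ?_ ?_)
  · rw [map_mul, Valuation.map_sub_swap _ (1 : K) a']
    exact mul_le_mul' (v_mul_one_sub_le_corner ρ s e hg ha) (ha'.trans hρs)
  · rw [map_mul]
    exact mul_le_mul' (v_mul_one_sub_le_corner ρ s e hg ha) ((v_mul_one_sub_le_corner ρ s e hg ha').trans hρe)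

/-! ## §2  Membership in the diagonal stabiliser of the general glued frame -/

/-- **`diag(u)·latt V = latt V` ON THE GENERAL GLUED FRAME ⟺ (a) ∧ (b) ∧ (c)**: for units `u`, `V = (1 0 0; x ϖ^ρ 0; xζ+y″ ϖ^ρζ ϖ^{2ρ+s+e})`, `|x| = |ζ| = 1`:
(a) `|u₁−u₀| ≤ |ϖ|^ρ`, (b) `|u₂−u₁| ≤ |ϖ|^{ρ+s+e}`, (c) `|xζ(u₂−u₁) + y″(u₂−u₀)| ≤ |ϖ|^{2ρ+s+e}` (★ `mapGL_latt_hnf_eq_iff`; `e = 0`: ★ FILE 1 `mem_latticeStabilizer_latt_glued_exp_iff`).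
[cite: Serre1980Trees, II §1.1] [cite: Kottwitz1986BaseChangeUnits, §1 pp. 240–241] -/
theorem mem_latticeStabilizer_latt_glued_corner_iff {ϖ : K} (hϖ0 : ϖ ≠ 0) (ρ s e : ℕ) {x ζ y'' : K} (hx : Valued.v x = 1) (hζ : Valued.v ζ = 1)
    (V : GL (Fin 3) K) (hV : (V : Matrix (Fin 3) (Fin 3) K) = !![1, 0, 0; x, ϖ ^ ρ, 0; x * ζ + y'', ϖ ^ ρ * ζ, ϖ ^ (2 * ρ + s + e)])
    (u : Fin 3 → Kˣ) (hu : ∀ i, Valued.v (u i : K) = 1) :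
    u ∈ latticeStabilizer (latt (V : Matrix (Fin 3) (Fin 3) K)) ↔
      Valued.v ((u 1 : K) - u 0) ≤ Valued.v ϖ ^ ρ ∧ Valued.v ((u 2 : K) - u 1) ≤ Valued.v ϖ ^ (ρ + s + e) ∧
        Valued.v (x * ζ * ((u 2 : K) - u 1) + y'' * ((u 2 : K) - u 0)) ≤ Valued.v ϖ ^ (2 * ρ + s + e) := by
  have hvϖ : 0 < Valued.v ϖ := (Valuation.pos_iff _).2 hϖ0
  have hb : (ϖ ^ ρ : K) ≠ 0 := pow_ne_zero _ hϖ0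
  have hc : (ϖ ^ (2 * ρ + s + e) : K) ≠ 0 := pow_ne_zero _ hϖ0
  rw [mem_latticeStabilizer_iff, mapGL_latt_hnf_eq_iff hϖ0 (fun i => (u i : K)) hu (diagGLUnits u) (coe_diagGLUnits u) V hV]
  refine and_congr ?_ (and_congr ?_ ?_)
  · rw [v_mul_inv_le_one_iff hb, map_mul, hx, mul_one, map_pow]
  · rw [v_mul_inv_le_one_iff hc, map_mul, map_mul, map_pow, hζ, mul_one, map_pow,
      show Valued.v ϖ ^ (2 * ρ + s + e) = Valued.v ϖ ^ (ρ + s + e) * Valued.v ϖ ^ ρ by rw [← pow_add]; congr 1; ring]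
    exact mul_le_mul_iff_left₀ (pow_pos hvϖ _)
  · have e3 : ((u 2 : K) - u 0) * (x * ζ + y'') + ((u 0 : K) - u 1) * x * (ϖ ^ ρ * ζ) * (ϖ ^ ρ)⁻¹ =
        x * ζ * ((u 2 : K) - u 1) + y'' * ((u 2 : K) - u 0) := by
      field_simp
      ring
    rw [v_mul_inv_le_one_iff hc, e3, map_pow]

/-- **`S_F(latt V)` ON THE GENERAL GLUED FRAME ⟺ (b) ∧ (c′)** for `u ∈ 𝒰` and any lineariser `g` (`|g|·|ϖ|^s ≤ 1`, `|xζ − g·y″| ≤ |ϖ|^ρ`):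
`u ∈ S_F(latt V) ⟺ |u₂−u₁| ≤ |ϖ|^{ρ+s+e} ∧ |g(u₂−u₁) + (u₂−u₀)| ≤ |ϖ|^{2ρ+e}`. [cite: Kottwitz1986BaseChangeUnits, §1 pp. 240–241] -/
theorem mem_fixedUnitStabilizer_latt_glued_corner_iff {σ : K →+* K} {ϖ : K} (hϖ0 : ϖ ≠ 0) (hϖ1 : Valued.v ϖ ≤ 1) (ρ s e : ℕ) {x ζ y'' g : K}
    (hx : Valued.v x = 1) (hζ : Valued.v ζ = 1) (hy'' : Valued.v y'' = Valued.v ϖ ^ s) (hg : Valued.v g * Valued.v ϖ ^ s ≤ 1)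
    (hlin : Valued.v (x * ζ - g * y'') ≤ Valued.v ϖ ^ ρ)
    (V : GL (Fin 3) K) (hV : (V : Matrix (Fin 3) (Fin 3) K) = !![1, 0, 0; x, ϖ ^ ρ, 0; x * ζ + y'', ϖ ^ ρ * ζ, ϖ ^ (2 * ρ + s + e)])
    {u : Fin 3 → Kˣ} (hu : u ∈ fixedUnitTorus σ 3) :
    u ∈ fixedUnitStabilizer σ (latt (V : Matrix (Fin 3) (Fin 3) K)) ↔
      Valued.v ((u 2 : K) - u 1) ≤ Valued.v ϖ ^ (ρ + s + e) ∧ Valued.v (g * ((u 2 : K) - u 1) + ((u 2 : K) - u 0)) ≤ Valued.v ϖ ^ (2 * ρ + e) := by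
  obtain ⟨hu1, hu2⟩ := (mem_fixedUnitTorus_iff σ u).1 hu
  rw [mem_fixedUnitStabilizer_iff, ← mem_latticeStabilizer_iff, mem_latticeStabilizer_latt_glued_corner_iff hϖ0 ρ s e hx hζ V hV u hu1]
  constructor
  · rintro ⟨⟨-, hb, hc⟩, -, -⟩
    exact ⟨hb, (glued_corner_iff_corner hϖ0 ρ s e hy'' hlin hb).1 hc⟩
  · rintro ⟨hb, hc'⟩
    have hc := (glued_corner_iff_corner hϖ0 ρ s e hy'' hlin hb).2 hc'
    refine ⟨⟨?_, hb, hc⟩, hu1, hu2⟩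
    have ha := glued_first_of_corner_corner hϖ1 ρ s e hg hb hc'
    rwa [show ((u 2 : K) - u 0) - ((u 2 : K) - u 1) = (u 1 : K) - u 0 by ring] at ha

/-! ## §3  Step 2 of the index at a general corner -/

/-- **STEP 2, general corner: `[S₁ : S_F(latt V)] = (q−1)·q^{(2ρ+e+1)∕2 − 1}`** (`S₁` at level `ρ+s+e`): the twisted map `u ↦ (u₀∕u₂)·(1 + g(1 − u₁∕u₂))⁻¹` is a homomorphism
`S₁ → K^×∕U_{2ρ+e}` (§1 defect), with kernel `S_F(latt V)` (§2, (c′)) and image `U_F·U_{2ρ+e}∕U_{2ρ+e}`, of cardinality `[U_F : U_{F,2ρ+e}]` (★ B1 (C4)).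
[cite: Kottwitz1986BaseChangeUnits, §1 pp. 240–241] [cite: Serre1979, Ch. IV §2 Prop. 6] -/
theorem relIndex_fixedUnitStabilizer_ratioLevel_corner_eq {σ : K →+* K} (hσ : ∀ a, σ (σ a) = a) (hvσ : ∀ a, Valued.v (σ a) = Valued.v a)
    (hfix : ∀ x : K, σ x = x → x ≠ 0 → ∃ n : ℤ, Valued.v x = WithZero.exp (2 * n)) {ϖ : K} (hϖ : Valued.v ϖ = WithZero.exp (-1 : ℤ))
    {d : ℕ} (hd : Valued.v (ϖ - σ ϖ) = Valued.v ϖ ^ d) [Finite 𝓀[K]] {ρ : ℕ} (hρ : 1 ≤ ρ) (s e : ℕ) {x ζ y'' g : K}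
    (hx : Valued.v x = 1) (hζ : Valued.v ζ = 1) (hy'' : Valued.v y'' = Valued.v ϖ ^ s) (hσg : σ g = g) (hg : Valued.v g * Valued.v ϖ ^ s ≤ 1)
    (hlin : Valued.v (x * ζ - g * y'') ≤ Valued.v ϖ ^ ρ)
    (V : GL (Fin 3) K) (hV : (V : Matrix (Fin 3) (Fin 3) K) = !![1, 0, 0; x, ϖ ^ ρ, 0; x * ζ + y'', ϖ ^ ρ * ζ, ϖ ^ (2 * ρ + s + e)])
    (π : (Fin 3 → Kˣ) →* Kˣ) (hπ : ∀ u, π u = u 1 / u 2)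
    (Uρs : Subgroup Kˣ) (hU : ∀ w : Kˣ, w ∈ Uρs ↔ Valued.v (w : K) = 1 ∧ Valued.v ((w : K) - 1) ≤ Valued.v ϖ ^ (ρ + s + e)) :
    (fixedUnitStabilizer σ (latt (V : Matrix (Fin 3) (Fin 3) K))).relIndex (Uρs.comap π ⊓ fixedUnitTorus σ 3) =
      (Nat.card 𝓀[K] - 1) * Nat.card 𝓀[K] ^ ((2 * ρ + e + 1) / 2 - 1) := by
  obtain ⟨hϖ0, hϖ1⟩ := ne_zero_and_v_lt_one_of_v_eq_exp hϖ
  set T := fixedUnitTorus σ 3 with hT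
  set S := fixedUnitStabilizer σ (latt (V : Matrix (Fin 3) (Fin 3) K)) with hS
  set S₁ := Uρs.comap π ⊓ T with hS₁
  -- the level-`2ρ+e` subgroup of `K^×`
  obtain ⟨U2, hU2⟩ := exists_unitLevel_subgroup (K := K) (Valued.v ϖ ^ (2 * ρ + e))
  have hρse : Valued.v ϖ ^ (ρ + s + e) ≤ Valued.v ϖ ^ (ρ + s) := pow_le_pow_right_of_le_one' hϖ1.le (by omega)
  -- membership in `S₁`, read in `K`
  have mem_S₁ : ∀ u : Fin 3 → Kˣ, u ∈ S₁ ↔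
      (Valued.v ((u 1 : K) / (u 2 : K)) = 1 ∧ Valued.v ((u 1 : K) / (u 2 : K) - 1) ≤ Valued.v ϖ ^ (ρ + s + e)) ∧
        (∀ i, Valued.v (u i : K) = 1) ∧ ∀ i, σ (u i) = u i := by
    intro u
    rw [hS₁, Subgroup.mem_inf, Subgroup.mem_comap, hU, hπ, Units.val_div_eq_div_val, hT, mem_fixedUnitTorus_iff]
  -- the twisted ratio and its properties
  have hcu : ∀ u ∈ S₁, Valued.v (g * (1 - (u 1 : K) / (u 2 : K))) ≤ Valued.v ϖ ^ ρ ∧ Valued.v (1 + g * (1 - (u 1 : K) / (u 2 : K))) = 1 :=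
    fun u hu => v_one_add_mul_one_sub_eq_one hϖ1 hρ s hg (((mem_S₁ u).1 hu).1.2.trans hρse)
  have hval : ∀ u ∈ S₁, Valued.v (((u 0 : K) / (u 2 : K)) / (1 + g * (1 - (u 1 : K) / (u 2 : K)))) = 1 := fun u hu => by
    obtain ⟨-, hu1, -⟩ := (mem_S₁ u).1 hu
    rw [map_div₀, map_div₀, hu1 0, hu1 2, (hcu u hu).2, div_one, div_one]
  have hne : ∀ u ∈ S₁, ((u 0 : K) / (u 2 : K)) / (1 + g * (1 - (u 1 : K) / (u 2 : K))) ≠ 0 := fun u hu h => by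
    have h1 := hval u hu
    rw [h, map_zero] at h1
    exact zero_ne_one h1
  have hc0 : ∀ u ∈ S₁, (1 + g * (1 - (u 1 : K) / (u 2 : K))) ≠ 0 := fun u hu h => by
    have h1 := (hcu u hu).2
    rw [h, map_zero] at h1
    exact zero_ne_one h1
  let θ : S₁ → Kˣ := fun u => Units.mk0 _ (hne u.1 u.2)
  have hθ : ∀ u : S₁, ((θ u : Kˣ) : K) = ((u.1 0 : K) / (u.1 2 : K)) / (1 + g * (1 - (u.1 1 : K) / (u.1 2 : K))) := fun u => rfl
  -- `θ` is a homomorphism modulo `U_{2ρ+e}`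
  have hmul : ∀ u u' : S₁, (QuotientGroup.mk' U2) (θ (u * u')) = (QuotientGroup.mk' U2) (θ u) * (QuotientGroup.mk' U2) (θ u') := by
    intro u u'
    obtain ⟨⟨-, ha⟩, hu1, -⟩ := (mem_S₁ u.1).1 u.2
    obtain ⟨⟨-, ha'⟩, hu1', -⟩ := (mem_S₁ u'.1).1 u'.2
    have hcc := (hcu u.1 u.2).2
    have hcc' := (hcu u'.1 u'.2).2
    have hC := (hcu (u * u').1 (u * u').2).2
    have hC0 := hc0 (u * u').1 (u * u').2
    rw [← map_mul, QuotientGroup.mk'_apply, QuotientGroup.mk'_apply, QuotientGroup.eq_iff_div_mem, hU2, Units.val_div_eq_div_val, Units.val_mul,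
      hθ, hθ, hθ]
    have ea : ((u * u').1 1 : K) / ((u * u').1 2 : K) = (u.1 1 : K) / (u.1 2 : K) * ((u'.1 1 : K) / (u'.1 2 : K)) := by
      simp only [Subgroup.coe_mul, Pi.mul_apply, Units.val_mul]; rw [mul_div_mul_comm]
    have eb : ((u * u').1 0 : K) / ((u * u').1 2 : K) = (u.1 0 : K) / (u.1 2 : K) * ((u'.1 0 : K) / (u'.1 2 : K)) := by
      simp only [Subgroup.coe_mul, Pi.mul_apply, Units.val_mul]; rw [mul_div_mul_comm]
    rw [ea] at hC hC0
    rw [ea, eb]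
    have hb0 : (u.1 0 : K) / (u.1 2 : K) ≠ 0 := div_ne_zero (u.1 0).ne_zero (u.1 2).ne_zero
    have hb0' : (u'.1 0 : K) / (u'.1 2 : K) ≠ 0 := div_ne_zero (u'.1 0).ne_zero (u'.1 2).ne_zero
    have hc1 := hc0 u.1 u.2
    have hc2 := hc0 u'.1 u'.2
    have key : (u.1 0 : K) / (u.1 2 : K) * ((u'.1 0 : K) / (u'.1 2 : K)) / (1 + g * (1 - (u.1 1 : K) / (u.1 2 : K) * ((u'.1 1 : K) / (u'.1 2 : K)))) /
        ((u.1 0 : K) / (u.1 2 : K) / (1 + g * (1 - (u.1 1 : K) / (u.1 2 : K))) * ((u'.1 0 : K) / (u'.1 2 : K) / (1 + g * (1 - (u'.1 1 : K) / (u'.1 2 : K))))) =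
        (1 + g * (1 - (u.1 1 : K) / (u.1 2 : K))) * (1 + g * (1 - (u'.1 1 : K) / (u'.1 2 : K))) / (1 + g * (1 - (u.1 1 : K) / (u.1 2 : K) * ((u'.1 1 : K) / (u'.1 2 : K)))) := by
      field_simp
    rw [key]
    refine ⟨by rw [map_div₀, map_mul, hcc, hcc', hC, one_mul, div_one], ?_⟩
    rw [div_sub_one hC0, map_div₀, hC, div_one]
    exact v_defect_le_corner hϖ1.le ρ s e hg ha ha'
  let Θ : S₁ →* Kˣ ⧸ U2 := MonoidHom.mk' (fun u => (QuotientGroup.mk' U2) (θ u)) hmul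
  have hΘ : ∀ u : S₁, Θ u = (QuotientGroup.mk' U2) (θ u) := fun u => rfl
  -- kernel `= S_F`
  have hker : Θ.ker = S.subgroupOf S₁ := by
    ext u
    obtain ⟨⟨ha1, ha⟩, hu1, hu2⟩ := (mem_S₁ u.1).1 u.2
    rw [MonoidHom.mem_ker, Subgroup.mem_subgroupOf, hΘ, QuotientGroup.mk'_apply, QuotientGroup.eq_one_iff, hU2, hθ, hS,
      mem_fixedUnitStabilizer_latt_glued_corner_iff hϖ0 hϖ1.le ρ s e hx hζ hy'' hg hlin V hV ((mem_fixedUnitTorus_iff σ _).2 ⟨hu1, hu2⟩)]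
    have hb : Valued.v ((u.1 2 : K) - u.1 1) ≤ Valued.v ϖ ^ (ρ + s + e) := by rwa [v_div_sub_one_eq (hu1 2)] at ha
    have h2 : (u.1 2 : K) ≠ 0 := (u.1 2).ne_zero
    have e1 : (u.1 0 : K) / (u.1 2 : K) - (1 + g * (1 - (u.1 1 : K) / (u.1 2 : K))) = -(g * ((u.1 2 : K) - u.1 1) + ((u.1 2 : K) - u.1 0)) / (u.1 2 : K) := by
      field_simp
      ring
    have hv2 : Valued.v (((u.1 0 : K) / (u.1 2 : K)) / (1 + g * (1 - (u.1 1 : K) / (u.1 2 : K))) - 1) =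
        Valued.v (g * ((u.1 2 : K) - u.1 1) + ((u.1 2 : K) - u.1 0)) := by
      rw [div_sub_one (hc0 u.1 u.2), map_div₀, (hcu u.1 u.2).2, div_one, e1, map_div₀, Valuation.map_neg, hu1 2, div_one]
    rw [hv2]
    exact ⟨fun h => ⟨hb, h.2⟩, fun h => ⟨hval u.1 u.2, h.2⟩⟩
  -- image `= U_F · U_{2ρ+e} ∕ U_{2ρ+e}`
  have hrange : Θ.range = ((fixedUnitTorus σ 3).map π).map (QuotientGroup.mk' U2) := by
    ext q
    constructor
    · intro hq
      obtain ⟨u, rfl⟩ := MonoidHom.mem_range.1 hq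
      obtain ⟨-, -, hu2⟩ := (mem_S₁ u.1).1 u.2
      refine Subgroup.mem_map.2 ⟨θ u, ?_, (hΘ u).symm⟩
      rw [mem_map_fixedUnitTorus_iff σ π hπ, hθ]
      exact ⟨by simp only [map_div₀, map_add, map_one, map_mul, map_sub, hσg, hu2], hval u.1 u.2⟩
    · intro hq
      obtain ⟨w, hw, rfl⟩ := Subgroup.mem_map.1 hq
      rw [mem_map_fixedUnitTorus_iff σ π hπ] at hw
      have h10 : (1 : Fin 3) ≠ 0 := by decide
      have h20 : (2 : Fin 3) ≠ 0 := by decide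
      have hu : Pi.mulSingle (0 : Fin 3) w ∈ S₁ := by
        rw [mem_S₁]
        refine ⟨?_, fun i => ?_, fun i => ?_⟩
        · rw [Pi.mulSingle_eq_of_ne h10, Pi.mulSingle_eq_of_ne h20, Units.val_one, div_one, sub_self, map_one, map_zero]
          exact ⟨rfl, zero_le⟩
        · by_cases hi : i = 0
          · subst hi; rw [Pi.mulSingle_eq_same]; exact hw.2
          · rw [Pi.mulSingle_eq_of_ne hi, Units.val_one, map_one]
        · by_cases hi : i = 0
          · subst hi; rw [Pi.mulSingle_eq_same]; exact hw.1
          · rw [Pi.mulSingle_eq_of_ne hi, Units.val_one, map_one]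
      refine ⟨⟨_, hu⟩, ?_⟩
      rw [hΘ]
      congr 1
      ext
      rw [hθ]
      simp only [Pi.mulSingle_eq_same, Pi.mulSingle_eq_of_ne h10, Pi.mulSingle_eq_of_ne h20, Units.val_one, div_one, sub_self, mul_zero, add_zero]
  -- count
  have h1 : S.relIndex S₁ = (S.subgroupOf S₁).index := rfl
  rw [h1, ← hker, Subgroup.index_ker, hrange, ← Subgroup.relIndex_ker, QuotientGroup.ker_mk', ← Subgroup.inf_relIndex_right]
  exact relIndex_fixedUnitLevel_eq hσ hvσ hfix hϖ hd (U := (fixedUnitTorus σ 3).map π) (Un := U2 ⊓ (fixedUnitTorus σ 3).map π)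
    (fun w => mem_map_fixedUnitTorus_iff σ π hπ w) (n := 2 * ρ + e) (by omega)
    (fun w => by rw [Subgroup.mem_inf, hU2, mem_map_fixedUnitTorus_iff σ π hπ, v_pow_eq_exp_neg hϖ]; tauto)

/-! ## §4  Heads at a general corner; the type-2 letters `e = 1` -/

/-- **THE GLUED STABILISER INDEX AT A GENERAL CORNER, LINEARISER FORM**: with a `σ`-fixed lineariser `g` (`|g|·|ϖ|^s ≤ 1`, `|xζ − g y″| ≤ |ϖ|^ρ`),
`[𝒰 : S_F(latt V)] = ((q−1)q^{(ρ+s+e+1)∕2−1})·((q−1)q^{(2ρ+e+1)∕2−1})`. [cite: Kottwitz1986BaseChangeUnits, §1 pp. 240–241] [cite: Serre1979, Ch. IV §2 Prop. 6] -/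
theorem relIndex_fixedUnitStabilizer_latt_glued_corner_eq_of_lineariser {σ : K →+* K} (hσ : ∀ a, σ (σ a) = a) (hvσ : ∀ a, Valued.v (σ a) = Valued.v a)
    (hfix : ∀ x : K, σ x = x → x ≠ 0 → ∃ n : ℤ, Valued.v x = WithZero.exp (2 * n)) {ϖ : K} (hϖ : Valued.v ϖ = WithZero.exp (-1 : ℤ))
    {d : ℕ} (hd : Valued.v (ϖ - σ ϖ) = Valued.v ϖ ^ d) [Finite 𝓀[K]] {ρ : ℕ} (hρ : 1 ≤ ρ) (s e : ℕ) {x ζ y'' g : K}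
    (hx : Valued.v x = 1) (hζ : Valued.v ζ = 1) (hy'' : Valued.v y'' = Valued.v ϖ ^ s) (hσg : σ g = g) (hg : Valued.v g * Valued.v ϖ ^ s ≤ 1)
    (hlin : Valued.v (x * ζ - g * y'') ≤ Valued.v ϖ ^ ρ)
    (V : GL (Fin 3) K) (hV : (V : Matrix (Fin 3) (Fin 3) K) = !![1, 0, 0; x, ϖ ^ ρ, 0; x * ζ + y'', ϖ ^ ρ * ζ, ϖ ^ (2 * ρ + s + e)]) :
    (fixedUnitStabilizer σ (latt (V : Matrix (Fin 3) (Fin 3) K))).relIndex (fixedUnitTorus σ 3) =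
      ((Nat.card 𝓀[K] - 1) * Nat.card 𝓀[K] ^ ((ρ + s + e + 1) / 2 - 1)) * ((Nat.card 𝓀[K] - 1) * Nat.card 𝓀[K] ^ ((2 * ρ + e + 1) / 2 - 1)) := by
  obtain ⟨hϖ0, hϖ1⟩ := ne_zero_and_v_lt_one_of_v_eq_exp hϖ
  obtain ⟨Uρs, hU⟩ := exists_unitLevel_subgroup (K := K) (Valued.v ϖ ^ (ρ + s + e))
  let π : (Fin 3 → Kˣ) →* Kˣ := Pi.evalMonoidHom (fun _ : Fin 3 => Kˣ) 1 / Pi.evalMonoidHom (fun _ : Fin 3 => Kˣ) 2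
  have hπ : ∀ u, π u = u 1 / u 2 := fun u => rfl
  have hle : fixedUnitStabilizer σ (latt (V : Matrix (Fin 3) (Fin 3) K)) ≤ Uρs.comap π ⊓ fixedUnitTorus σ 3 := by
    intro u hu
    have huT : u ∈ fixedUnitTorus σ 3 := (Subgroup.mem_inf.1 hu).2
    obtain ⟨hb, -⟩ := (mem_fixedUnitStabilizer_latt_glued_corner_iff hϖ0 hϖ1.le ρ s e hx hζ hy'' hg hlin V hV huT).1 hu
    obtain ⟨hu1, -⟩ := (mem_fixedUnitTorus_iff σ u).1 huT
    refine Subgroup.mem_inf.2 ⟨?_, huT⟩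
    rw [Subgroup.mem_comap, hU, hπ, Units.val_div_eq_div_val, map_div₀, hu1 1, hu1 2, div_one, v_div_sub_one_eq (hu1 2)]
    exact ⟨rfl, hb⟩
  rw [← Subgroup.relIndex_mul_relIndex _ _ _ hle inf_le_right,
    relIndex_fixedUnitStabilizer_ratioLevel_corner_eq hσ hvσ hfix hϖ hd hρ s e hx hζ hy'' hσg hg hlin V hV π hπ Uρs hU,
    relIndex_ratioLevel_fixedUnitTorus_eq hσ hvσ hfix hϖ hd (n := ρ + s + e) (by omega) π hπ Uρs hU, Nat.mul_comm]

/-- **HEAD — THE GLUED STABILISER INDEX AT A GENERAL CORNER UNDER (R)**: for `V = (1 0 0; x ϖ^ρ 0; xζ+y″ ϖ^ρζ ϖ^{2ρ+s+e})` (`|x| = |ζ| = 1`, `|y″| = |ϖ|^s`,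
`ρ ≥ 1`, any `e`) over a ramified quadratic datum and `f = σf` with `|ζσy″ − σx·f| ≤ |ϖ|^{ρ+s}`:
`[𝒰 : S_F(latt V)] = ((q−1)·q^{(ρ+s+e+1)∕2 − 1}) · ((q−1)·q^{(2ρ+e+1)∕2 − 1})`. [cite: Kottwitz1986BaseChangeUnits, §1 pp. 240–241] [cite: Serre1979, Ch. IV §2 Prop. 6] -/
theorem relIndex_fixedUnitStabilizer_latt_glued_corner_eq {σ : K →+* K} (hσ : ∀ a, σ (σ a) = a) (hvσ : ∀ a, Valued.v (σ a) = Valued.v a)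
    (hfix : ∀ x : K, σ x = x → x ≠ 0 → ∃ n : ℤ, Valued.v x = WithZero.exp (2 * n)) {ϖ : K} (hϖ : Valued.v ϖ = WithZero.exp (-1 : ℤ))
    {d : ℕ} (hd : Valued.v (ϖ - σ ϖ) = Valued.v ϖ ^ d) [Finite 𝓀[K]] {ρ : ℕ} (hρ : 1 ≤ ρ) (s e : ℕ) {x ζ y'' : K}
    (hx : Valued.v x = 1) (hζ : Valued.v ζ = 1) (hy'' : Valued.v y'' = Valued.v ϖ ^ s)
    (V : GL (Fin 3) K) (hV : (V : Matrix (Fin 3) (Fin 3) K) = !![1, 0, 0; x, ϖ ^ ρ, 0; x * ζ + y'', ϖ ^ ρ * ζ, ϖ ^ (2 * ρ + s + e)])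
    {f : K} (hf : σ f = f) (hR : Valued.v (ζ * σ y'' - σ x * f) ≤ Valued.v ϖ ^ (ρ + s)) :
    (fixedUnitStabilizer σ (latt (V : Matrix (Fin 3) (Fin 3) K))).relIndex (fixedUnitTorus σ 3) =
      ((Nat.card 𝓀[K] - 1) * Nat.card 𝓀[K] ^ ((ρ + s + e + 1) / 2 - 1)) * ((Nat.card 𝓀[K] - 1) * Nat.card 𝓀[K] ^ ((2 * ρ + e + 1) / 2 - 1)) := by
  obtain ⟨hϖ0, hϖ1⟩ := ne_zero_and_v_lt_one_of_v_eq_exp hϖ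
  obtain ⟨-, hσg, hg, hlin⟩ := lineariser_of_criterionR hσ hvσ hϖ0 hϖ1 hρ s hx hζ hy'' hf hR
  exact relIndex_fixedUnitStabilizer_latt_glued_corner_eq_of_lineariser hσ hvσ hfix hϖ hd hρ s e hx hζ hy'' hσg hg.le hlin V hV

/-- **THE WEIGHT AT A GENERAL CORNER**: `stabiliserWeight σ (latt V) = (((q−1)q^{(ρ+s+e+1)∕2−1})·((q−1)q^{(2ρ+e+1)∕2−1}))⁻¹`. [cite: Kottwitz1986BaseChangeUnits, §1 pp. 240–241] -/
theorem stabiliserWeight_latt_glued_corner_eq {σ : K →+* K} (hσ : ∀ a, σ (σ a) = a) (hvσ : ∀ a, Valued.v (σ a) = Valued.v a)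
    (hfix : ∀ x : K, σ x = x → x ≠ 0 → ∃ n : ℤ, Valued.v x = WithZero.exp (2 * n)) {ϖ : K} (hϖ : Valued.v ϖ = WithZero.exp (-1 : ℤ))
    {d : ℕ} (hd : Valued.v (ϖ - σ ϖ) = Valued.v ϖ ^ d) [Finite 𝓀[K]] {ρ : ℕ} (hρ : 1 ≤ ρ) (s e : ℕ) {x ζ y'' : K}
    (hx : Valued.v x = 1) (hζ : Valued.v ζ = 1) (hy'' : Valued.v y'' = Valued.v ϖ ^ s)
    (V : GL (Fin 3) K) (hV : (V : Matrix (Fin 3) (Fin 3) K) = !![1, 0, 0; x, ϖ ^ ρ, 0; x * ζ + y'', ϖ ^ ρ * ζ, ϖ ^ (2 * ρ + s + e)])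
    {f : K} (hf : σ f = f) (hR : Valued.v (ζ * σ y'' - σ x * f) ≤ Valued.v ϖ ^ (ρ + s)) :
    stabiliserWeight σ (latt (V : Matrix (Fin 3) (Fin 3) K)) =
      ((((Nat.card 𝓀[K] - 1) * Nat.card 𝓀[K] ^ ((ρ + s + e + 1) / 2 - 1)) * ((Nat.card 𝓀[K] - 1) * Nat.card 𝓀[K] ^ ((2 * ρ + e + 1) / 2 - 1)) : ℕ) : ℚ)⁻¹ := by
  unfold stabiliserWeight
  rw [relIndex_fixedUnitStabilizer_latt_glued_corner_eq hσ hvσ hfix hϖ hd hρ s e hx hζ hy'' V hV hf hR]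

/-- **THE TYPE-2 GLUED STRATUM `G₁(2ρ+1, s)`** (MEMO v2.1 §T2.3: `c = 2ρ+1+s`, `|y″| = |ϖ|^s`; `e = 1`): under (R) at level `ρ+s`,
`[𝒰 : S_F(latt V)] = ((q−1)·q^{(ρ+s+2)∕2 − 1}) · ((q−1)·q^{ρ})` (`= (q−1)²·q^{⌊(ρ+s)∕2⌋+ρ}`). [cite: Kottwitz1986BaseChangeUnits, §1 pp. 240–241] [cite: Serre1979, Ch. IV §2 Prop. 6] -/
theorem relIndex_fixedUnitStabilizer_latt_glued_typeTwo_eq {σ : K →+* K} (hσ : ∀ a, σ (σ a) = a) (hvσ : ∀ a, Valued.v (σ a) = Valued.v a)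
    (hfix : ∀ x : K, σ x = x → x ≠ 0 → ∃ n : ℤ, Valued.v x = WithZero.exp (2 * n)) {ϖ : K} (hϖ : Valued.v ϖ = WithZero.exp (-1 : ℤ))
    {d : ℕ} (hd : Valued.v (ϖ - σ ϖ) = Valued.v ϖ ^ d) [Finite 𝓀[K]] {ρ : ℕ} (hρ : 1 ≤ ρ) (s : ℕ) {x ζ y'' : K}
    (hx : Valued.v x = 1) (hζ : Valued.v ζ = 1) (hy'' : Valued.v y'' = Valued.v ϖ ^ s)
    (V : GL (Fin 3) K) (hV : (V : Matrix (Fin 3) (Fin 3) K) = !![1, 0, 0; x, ϖ ^ ρ, 0; x * ζ + y'', ϖ ^ ρ * ζ, ϖ ^ (2 * ρ + 1 + s)])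
    {f : K} (hf : σ f = f) (hR : Valued.v (ζ * σ y'' - σ x * f) ≤ Valued.v ϖ ^ (ρ + s)) :
    (fixedUnitStabilizer σ (latt (V : Matrix (Fin 3) (Fin 3) K))).relIndex (fixedUnitTorus σ 3) =
      ((Nat.card 𝓀[K] - 1) * Nat.card 𝓀[K] ^ ((ρ + s + 2) / 2 - 1)) * ((Nat.card 𝓀[K] - 1) * Nat.card 𝓀[K] ^ ρ) := by
  have hV1 : (V : Matrix (Fin 3) (Fin 3) K) = !![1, 0, 0; x, ϖ ^ ρ, 0; x * ζ + y'', ϖ ^ ρ * ζ, ϖ ^ (2 * ρ + s + 1)] := by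
    rw [hV, show 2 * ρ + 1 + s = 2 * ρ + s + 1 by ring]
  rw [relIndex_fixedUnitStabilizer_latt_glued_corner_eq hσ hvσ hfix hϖ hd hρ s 1 hx hζ hy'' V hV1 hf hR]
  have e1 : (ρ + s + 1 + 1) / 2 - 1 = (ρ + s + 2) / 2 - 1 := by omega
  have e2 : (2 * ρ + 1 + 1) / 2 - 1 = ρ := by omega
  rw [e1, e2]

/-- **THE TYPE-2 WEIGHT**: `stabiliserWeight σ (latt V) = (((q−1)q^{(ρ+s+2)∕2−1})·((q−1)q^{ρ}))⁻¹` on `G₁(2ρ+1, s)`. [cite: Kottwitz1986BaseChangeUnits, §1 pp. 240–241] -/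
theorem stabiliserWeight_latt_glued_typeTwo_eq {σ : K →+* K} (hσ : ∀ a, σ (σ a) = a) (hvσ : ∀ a, Valued.v (σ a) = Valued.v a)
    (hfix : ∀ x : K, σ x = x → x ≠ 0 → ∃ n : ℤ, Valued.v x = WithZero.exp (2 * n)) {ϖ : K} (hϖ : Valued.v ϖ = WithZero.exp (-1 : ℤ))
    {d : ℕ} (hd : Valued.v (ϖ - σ ϖ) = Valued.v ϖ ^ d) [Finite 𝓀[K]] {ρ : ℕ} (hρ : 1 ≤ ρ) (s : ℕ) {x ζ y'' : K}
    (hx : Valued.v x = 1) (hζ : Valued.v ζ = 1) (hy'' : Valued.v y'' = Valued.v ϖ ^ s)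
    (V : GL (Fin 3) K) (hV : (V : Matrix (Fin 3) (Fin 3) K) = !![1, 0, 0; x, ϖ ^ ρ, 0; x * ζ + y'', ϖ ^ ρ * ζ, ϖ ^ (2 * ρ + 1 + s)])
    {f : K} (hf : σ f = f) (hR : Valued.v (ζ * σ y'' - σ x * f) ≤ Valued.v ϖ ^ (ρ + s)) :
    stabiliserWeight σ (latt (V : Matrix (Fin 3) (Fin 3) K)) =
      ((((Nat.card 𝓀[K] - 1) * Nat.card 𝓀[K] ^ ((ρ + s + 2) / 2 - 1)) * ((Nat.card 𝓀[K] - 1) * Nat.card 𝓀[K] ^ ρ) : ℕ) : ℚ)⁻¹ := by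
  unfold stabiliserWeight
  rw [relIndex_fixedUnitStabilizer_latt_glued_typeTwo_eq hσ hvσ hfix hϖ hd hρ s hx hζ hy'' V hV hf hR]

end Summit.HodgeConjecture.HodgeConjecture.Cruxes.H413.F0P3cDyRamDiagonalGluedStabiliserIndexCorner

end
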